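import Literature.FieldTheory.Regular.RegularExtension
import Literature.RingTheory.KrullDimension.BaseChangeDimension
import Mathlib.RingTheory.AlgebraicIndependent.Basic
import HarnessLib

/-!
# Base change of the ideal of a point along a field embedding

Let `L → F'` be a homomorphism of fields (an `L`-algebra structure on the field `F'`), `P` an
ideal of `L[X_ι]` and `P' = P F'[X_ι]` its extension. The quotient `F'[X_ι]/P'` is the base change
`F' ⊗ₗ L[X_ι]/P` (`Literature.FieldTheory.Regular.exists_algEquiv_quotient_map_tensor`); since
`F'` is free over `L` this gives, for *any* `P`:

* `Literature.FieldTheory.Regular.map_mem_map_iff` — `P' ∩ L[X_ι] = P`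
  (`pᶠ ∈ P' ↔ p ∈ P`);
* `Literature.FieldTheory.Regular.algebraicIndependent_map_mk` — algebraically independent
  families in `L[X_ι]/P` stay algebraically independent over `F'` in `F'[X_ι]/P'`;
* `Literature.FieldTheory.Regular.exists_sub_C_mem_of_map_sub_C_mem` — descent of constants:
  if `pᶠ ≡ c (mod P')` for a constant `c ∈ F'` then `p ≡ e (mod P)` for a constant `e ∈ L` with
  `e ↦ c`;

and when `P = I(β/L)` is the prime ideal of a point over a relatively algebraically closed base
(so that `P'` is prime, `Literature.FieldTheory.Regular.isPrime_map_ker_aeval`):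

* `Literature.FieldTheory.Regular.ringKrullDim_quotient_map_eq` — `dim F'[X_ι]/P' = dim L[X_ι]/P`
  (the base change of an affine domain is equidimensional of the same dimension,
  `Literature.RingTheory.KrullDimension.ringKrullDim_quotient_tensorProduct_of_mem_minimalPrimes`).

These are the algebraic facts behind "the locus of a good basis keeps its dimension, its generic
relations and its freeness after transport along an isomorphism of the base" in the Bays–Kirby
theory (`Literature/NumberTheory/Transcendental`).

## References

* S. Lang, *Algebra*, GTM 211, VIII §4.
* U. Görtz, T. Wedhorn, *Algebraic Geometry I*, Prop. 5.38.
-/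

noncomputable section

open scoped TensorProduct
open MvPolynomial

namespace Literature.FieldTheory.Regular

universe u

variable {L F' : Type*} [Field L] [Field F'] [Algebra L F'] {ι : Type*}

/-- **`F'[X]/P F'[X] ≅ F' ⊗ₗ L[X]/P`**, with `p̄ᶠ ↦ 1 ⊗ p̄`. [folklore] -/
theorem exists_algEquiv_quotient_map_tensor (P : Ideal (MvPolynomial ι L)) :
    ∃ e : (MvPolynomial ι F' ⧸ P.map (MvPolynomial.map (algebraMap L F'))) ≃ₐ[F']
        F' ⊗[L] (MvPolynomial ι L ⧸ P),
      ∀ p : MvPolynomial ι L,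
        e (Ideal.Quotient.mk _ (MvPolynomial.map (algebraMap L F') p)) =
          (1 : F') ⊗ₜ[L] Ideal.Quotient.mk P p := by
  classical
  let e₁ : F' ⊗[L] (MvPolynomial ι L ⧸ P) ≃ₐ[F'] (F' ⊗[L] MvPolynomial ι L) ⧸ P.map
      (Algebra.TensorProduct.includeRight : MvPolynomial ι L →ₐ[L] F' ⊗[L] MvPolynomial ι L) :=
    Algebra.TensorProduct.tensorQuotientEquiv F' (MvPolynomial ι L) F' P
  let e₂ : F' ⊗[L] MvPolynomial ι L ≃ₐ[F'] MvPolynomial ι F' := MvPolynomial.algebraTensorAlgEquiv L F'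
  have he₂ : ∀ p : MvPolynomial ι L, e₂ (Algebra.TensorProduct.includeRight p) =
      MvPolynomial.map (algebraMap L F') p := fun p => by
    rw [Algebra.TensorProduct.includeRight_apply, MvPolynomial.algebraTensorAlgEquiv_tmul, one_smul]
  have hJ : Ideal.map (MvPolynomial.map (algebraMap L F')) P =
      (P.map (Algebra.TensorProduct.includeRight :
        MvPolynomial ι L →ₐ[L] F' ⊗[L] MvPolynomial ι L)).map (e₂ : _ →+* MvPolynomial ι F') := by
    rw [← Ideal.map_coe Algebra.TensorProduct.includeRight, Ideal.map_map]
    congr 1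
    apply RingHom.ext
    intro p
    exact (he₂ p).symm
  let e₃ := Ideal.quotientEquivAlg _ _ e₂ hJ
  refine ⟨(e₁.trans e₃).symm, fun p => ?_⟩
  rw [AlgEquiv.symm_apply_eq, AlgEquiv.trans_apply]
  rw [show e₁ ((1 : F') ⊗ₜ[L] Ideal.Quotient.mk P p) = Ideal.Quotient.mk _ ((1 : F') ⊗ₜ[L] p) from
    Algebra.TensorProduct.tensorQuotientEquiv_apply_tmul F' (MvPolynomial ι L) F' P 1 p]
  rw [show e₃ (Ideal.Quotient.mk _ ((1 : F') ⊗ₜ[L] p)) = Ideal.Quotient.mk _ (e₂ ((1 : F') ⊗ₜ[L] p)) from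
    Ideal.quotientEquivAlg_mk _ e₂ hJ _]
  congr 1
  rw [← he₂ p, Algebra.TensorProduct.includeRight_apply]

/-- **`P F'[X] ∩ L[X] = P`**: a polynomial over `L` lies in the extended ideal iff it lies in `P`
(faithful flatness of `F'` over `L`). [folklore] -/
theorem map_mem_map_iff (P : Ideal (MvPolynomial ι L)) (p : MvPolynomial ι L) :
    MvPolynomial.map (algebraMap L F') p ∈ P.map (MvPolynomial.map (algebraMap L F')) ↔ p ∈ P := by
  refine ⟨fun h => ?_, fun h => Ideal.mem_map_of_mem _ h⟩
  obtain ⟨e, he⟩ := exists_algEquiv_quotient_map_tensor (F' := F') P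
  have h1 : (Ideal.Quotient.mk _ (MvPolynomial.map (algebraMap L F') p) :
      MvPolynomial ι F' ⧸ P.map (MvPolynomial.map (algebraMap L F'))) = 0 :=
    Ideal.Quotient.eq_zero_iff_mem.2 h
  have h2 : ((1 : F') ⊗ₜ[L] Ideal.Quotient.mk P p : F' ⊗[L] (MvPolynomial ι L ⧸ P)) = 0 := by
    rw [← he p, h1, map_zero]
  have hinj : Function.Injective
      (Algebra.TensorProduct.includeRight : (MvPolynomial ι L ⧸ P) →ₐ[L] F' ⊗[L] (MvPolynomial ι L ⧸ P)) :=
    Algebra.TensorProduct.includeRight_injective (algebraMap L F').injective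
  have h3 : Ideal.Quotient.mk P p = 0 := hinj (by rw [Algebra.TensorProduct.includeRight_apply, h2, map_zero])
  exact Ideal.Quotient.eq_zero_iff_mem.1 h3

/-- **Algebraic independence survives the base change**: if the classes of `f₁, …, f_r` in
`L[X]/P` are algebraically independent over `L`, the classes of `f₁ᶠ, …, f_rᶠ` in `F'[X]/P F'[X]`
are algebraically independent over `F'` (flatness of `F'` over `L`). [folklore] -/
theorem algebraicIndependent_map_mk (P : Ideal (MvPolynomial ι L)) {r : Type*}
    (f : r → MvPolynomial ι L)
    (hf : AlgebraicIndependent L fun k => Ideal.Quotient.mk P (f k)) :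
    AlgebraicIndependent F' fun k =>
      (Ideal.Quotient.mk (P.map (MvPolynomial.map (algebraMap L F')))
        (MvPolynomial.map (algebraMap L F') (f k))) := by
  classical
  obtain ⟨e, he⟩ := exists_algEquiv_quotient_map_tensor (F' := F') P
  rw [algebraicIndependent_iff_injective_aeval] at hf ⊢
  -- `aeval` at the new family is `e⁻¹ ∘ (id ⊗ aeval f̄) ∘ (F'[T] ≅ F' ⊗ L[T])`
  set v : r → MvPolynomial ι L ⧸ P := fun k => Ideal.Quotient.mk P (f k) with hv
  let Φ : MvPolynomial r F' →ₐ[F'] F' ⊗[L] (MvPolynomial ι L ⧸ P) :=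
    (Algebra.TensorProduct.map (AlgHom.id F' F') (aeval v)).comp
      (MvPolynomial.algebraTensorAlgEquiv L F').symm.toAlgHom
  have hΦ : ∀ q, e (aeval (fun k => (Ideal.Quotient.mk (P.map (MvPolynomial.map (algebraMap L F'))))
      (MvPolynomial.map (algebraMap L F') (f k))) q) = Φ q := by
    intro q
    have : (e : _ →ₐ[F'] _).comp (aeval fun k => (Ideal.Quotient.mk
        (P.map (MvPolynomial.map (algebraMap L F')))) (MvPolynomial.map (algebraMap L F') (f k))) = Φ := by
      refine MvPolynomial.algHom_ext fun k => ?_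
      rw [AlgHom.comp_apply, aeval_X]
      change e ((Ideal.Quotient.mk _) (MvPolynomial.map (algebraMap L F') (f k))) =
        (Algebra.TensorProduct.map (AlgHom.id F' F') (aeval v)) ((MvPolynomial.algebraTensorAlgEquiv L F').symm (X k))
      rw [he]
      have hX : (MvPolynomial.algebraTensorAlgEquiv L F').symm (X k : MvPolynomial r F') = (1 : F') ⊗ₜ[L] X k := by
        rw [AlgEquiv.symm_apply_eq, MvPolynomial.algebraTensorAlgEquiv_tmul, one_smul, map_X]
      rw [hX, Algebra.TensorProduct.map_tmul, AlgHom.coe_id, id_eq, aeval_X]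
    exact congrArg (fun g => g q) this
  have hmapinj : Function.Injective (Algebra.TensorProduct.map (AlgHom.id F' F') (aeval v) :
      F' ⊗[L] MvPolynomial r L →ₐ[F'] F' ⊗[L] (MvPolynomial ι L ⧸ P)) := by
    have : ((Algebra.TensorProduct.map (AlgHom.id F' F') (aeval v)) :
        F' ⊗[L] MvPolynomial r L → F' ⊗[L] (MvPolynomial ι L ⧸ P)) =
        LinearMap.lTensor F' (aeval v).toLinearMap := by
      ext z
      induction z using TensorProduct.induction_on with
      | zero => simp
      | tmul a b => simp
      | add x y hx hy => rw [map_add, map_add, hx, hy]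
    rw [this]
    exact Module.Flat.lTensor_preserves_injective_linearMap _ hf
  have hΦinj : Function.Injective Φ :=
    hmapinj.comp (MvPolynomial.algebraTensorAlgEquiv L F').symm.injective
  intro a b hab
  apply hΦinj
  rw [← hΦ, ← hΦ, hab]

/-- **Scalars in a base change.** In `F' ⊗ₗ A` (`A` an `L`-algebra, `F'` a field extension of
`L`), if `1 ⊗ a = c ⊗ 1` for some `c ∈ F'` then `a` is a scalar: `a = e · 1` with `e ↦ c`.
(Compare coordinates in an `F'`-basis `1 ⊗ aᵢ` coming from an `L`-basis `(aᵢ)` of `A` containing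
`1` and, if `a ∉ L · 1`, also `a`.) [folklore] -/
theorem exists_eq_algebraMap_of_one_tmul_eq_tmul_one {A : Type*} [CommRing A] [Algebra L A]
    [Nontrivial A] {a : A} {c : F'} (h : ((1 : F') ⊗ₜ[L] a : F' ⊗[L] A) = c ⊗ₜ[L] (1 : A)) :
    ∃ e : L, a = algebraMap L A e ∧ algebraMap L F' e = c := by
  classical
  -- first the scalar case
  have hscalar : ∀ e : L, a = algebraMap L A e → algebraMap L F' e = c := by
    intro e hae
    have h1 : ((1 : F') ⊗ₜ[L] a : F' ⊗[L] A) = algebraMap L F' e ⊗ₜ[L] (1 : A) := by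
      rw [hae, Algebra.algebraMap_eq_smul_one, TensorProduct.tmul_smul, TensorProduct.smul_tmul',
        Algebra.smul_def, mul_one]
    rw [h1] at h
    have hinj : Function.Injective
        (Algebra.TensorProduct.includeLeft : F' →ₐ[L] F' ⊗[L] A) :=
      Algebra.TensorProduct.includeLeft_injective (S := L) (FaithfulSMul.algebraMap_injective L A)
    exact hinj h
  by_cases hmem : a ∈ Set.range (algebraMap L A)
  · obtain ⟨e, rfl⟩ := hmem
    exact ⟨e, rfl, hscalar e rfl⟩
  · exfalso
    -- `![1, a]` is linearly independent; extend its range to a basis of `A`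
    have hli : LinearIndependent L ![(1 : A), a] := by
      rw [LinearIndependent.pair_iff]
      intro s t hst
      by_cases ht : t = 0
      · subst ht
        rw [zero_smul, add_zero, Algebra.smul_def, mul_one] at hst
        exact ⟨(algebraMap L A).injective (by rw [hst, map_zero]), rfl⟩
      · exfalso
        apply hmem
        refine ⟨-(s / t), ?_⟩
        have : t • a = -(s • (1 : A)) := eq_neg_of_add_eq_zero_right hst
        have h2 : a = t⁻¹ • (-(s • (1 : A))) := by
          rw [← this, smul_smul, inv_mul_cancel₀ ht, one_smul]
        rw [h2, Algebra.algebraMap_eq_smul_one, smul_neg, ← neg_smul, smul_smul]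
        congr 1
        rw [div_eq_mul_inv, mul_comm, neg_mul]
    have hlio : LinearIndepOn L id (Set.range ![(1 : A), a]) := hli.linearIndepOn_id
    let bA := Module.Basis.extend hlio
    have hsub := Module.Basis.subset_extend hlio
    let i₀ : hlio.extend (Set.subset_univ _) := ⟨1, hsub ⟨0, rfl⟩⟩
    let i₁ : hlio.extend (Set.subset_univ _) := ⟨a, hsub ⟨1, rfl⟩⟩
    have hb₀ : bA i₀ = 1 := Module.Basis.extend_apply_self hlio i₀
    have hb₁ : bA i₁ = a := Module.Basis.extend_apply_self hlio i₁
    have hne : i₀ ≠ i₁ := fun h01 => hmem ⟨1, by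
      rw [map_one]; exact congrArg Subtype.val h01⟩
    -- compare the `i₁`-coordinates in the `F'`-basis `1 ⊗ bA i`
    let T := Algebra.TensorProduct.basis F' bA
    have h1 : T.repr ((1 : F') ⊗ₜ[L] a) i₁ = 1 := by
      rw [show ((1 : F') ⊗ₜ[L] a : F' ⊗[L] A) = (1 : F') ⊗ₜ[L] bA i₁ by rw [hb₁],
        Algebra.TensorProduct.basis_repr_tmul, one_smul, Module.Basis.repr_self]
      simp
    have h2 : T.repr (c ⊗ₜ[L] (1 : A)) i₁ = 0 := by
      rw [show (c ⊗ₜ[L] (1 : A) : F' ⊗[L] A) = c ⊗ₜ[L] bA i₀ by rw [hb₀],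
        Algebra.TensorProduct.basis_repr_tmul, Module.Basis.repr_self]
      simp [Finsupp.single_eq_of_ne hne.symm]
    rw [h] at h1
    rw [h1] at h2
    exact one_ne_zero h2

/-- **Descent of constants.** If `pᶠ ≡ c (mod P F'[X])` for a constant `c ∈ F'` then
`p ≡ e (mod P)` for a constant `e ∈ L` with `e ↦ c` (for `P ≠ ⊤`). [folklore] -/
theorem exists_sub_C_mem_of_map_sub_C_mem {P : Ideal (MvPolynomial ι L)} (hP : P ≠ ⊤)
    (p : MvPolynomial ι L) (c : F')
    (h : MvPolynomial.map (algebraMap L F') p - C c ∈ P.map (MvPolynomial.map (algebraMap L F'))) :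
    ∃ e : L, p - C e ∈ P ∧ algebraMap L F' e = c := by
  obtain ⟨e, he⟩ := exists_algEquiv_quotient_map_tensor (F' := F') P
  haveI : Nontrivial (MvPolynomial ι L ⧸ P) := Ideal.Quotient.nontrivial_iff.2 hP
  have h1 : (Ideal.Quotient.mk (P.map (MvPolynomial.map (algebraMap L F')))
      (MvPolynomial.map (algebraMap L F') p)) = Ideal.Quotient.mk _ (C c) := by
    rw [Ideal.Quotient.eq]; exact h
  have h2 : ((1 : F') ⊗ₜ[L] Ideal.Quotient.mk P p : F' ⊗[L] (MvPolynomial ι L ⧸ P)) =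
      c ⊗ₜ[L] (1 : MvPolynomial ι L ⧸ P) := by
    rw [← he p, h1, ← MvPolynomial.algebraMap_eq, ← Ideal.Quotient.mkₐ_eq_mk F', AlgHom.commutes,
      AlgEquiv.commutes, Algebra.TensorProduct.algebraMap_apply, Algebra.algebraMap_self, RingHom.id_apply]
  obtain ⟨e', he', hec⟩ := exists_eq_algebraMap_of_one_tmul_eq_tmul_one h2
  refine ⟨e', ?_, hec⟩
  rw [← Ideal.Quotient.eq, he', ← Ideal.Quotient.mkₐ_eq_mk L, ← MvPolynomial.algebraMap_eq, AlgHom.commutes]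

/-- For an affine domain `A` over `L` whose base change `A ⊗ₗ F'` is again a domain,
`dim (A ⊗ₗ F') = dim A` (the base change is equidimensional,
`Literature.RingTheory.KrullDimension.ringKrullDim_quotient_tensorProduct_of_mem_minimalPrimes`,
and `(0)` is its only minimal prime). [folklore] -/
theorem ringKrullDim_tensorProduct_eq_of_isDomain {L F' : Type u} [Field L] [Field F'] [Algebra L F']
    (A : Type u) [CommRing A] [IsDomain A] [Algebra L A] [Algebra.FiniteType L A]
    [IsDomain (A ⊗[L] F')] : ringKrullDim (A ⊗[L] F') = ringKrullDim A := by
  have hbot : (⊥ : Ideal (A ⊗[L] F')) ∈ minimalPrimes (A ⊗[L] F') := by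
    rw [IsDomain.minimalPrimes_eq_singleton_bot]; exact Set.mem_singleton _
  have hdim := Literature.RingTheory.KrullDimension.ringKrullDim_quotient_tensorProduct_of_mem_minimalPrimes
    L F' A hbot
  rw [← hdim]
  refine le_antisymm ?_ (ringKrullDim_quotient_le ⊥)
  refine ringKrullDim_le_of_surjective
    (Ideal.Quotient.lift (⊥ : Ideal (A ⊗[L] F')) (RingHom.id _)
      (fun a ha => by rw [Ideal.mem_bot] at ha; rw [ha, map_zero])) (fun x => ?_)
  exact ⟨Ideal.Quotient.mk ⊥ x, by rw [Ideal.Quotient.lift_mk, RingHom.id_apply]⟩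

/-- **The base change keeps the dimension** (for the prime ideal of a point over a relatively
algebraically closed base, characteristic `0`): `dim F'[X]/P F'[X] = dim L[X]/P` for `P = I(β/L)`.
(`F'[X]/P F'[X] ≅ (L[X]/P) ⊗ₗ F'` is an integral domain by regularity, and every component of the
base change of an affine domain has the same dimension.) [cite: Lang2002, VIII §4] -/
theorem ringKrullDim_quotient_map_eq {L F' : Type u} [Field L] [CharZero L] [Field F'] [Algebra L F']
    {ι : Type u} [Finite ι] {Kr : Type*} [Field Kr] [Algebra L Kr] (β : ι → Kr)
    (hrac : ∀ z : Kr, IsAlgebraic L z → z ∈ Set.range (algebraMap L Kr)) :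
    ringKrullDim (MvPolynomial ι F' ⧸ (RingHom.ker (MvPolynomial.aeval β : MvPolynomial ι L →ₐ[L] Kr)).map
        (MvPolynomial.map (algebraMap L F'))) =
      ringKrullDim (MvPolynomial ι L ⧸ RingHom.ker (MvPolynomial.aeval β : MvPolynomial ι L →ₐ[L] Kr)) := by
  classical
  set P := RingHom.ker (MvPolynomial.aeval β : MvPolynomial ι L →ₐ[L] Kr) with hP
  haveI hP' : (P.map (MvPolynomial.map (algebraMap L F'))).IsPrime :=
    isPrime_map_ker_aeval (algebraMap L F') β hrac
  obtain ⟨e, -⟩ := exists_algEquiv_quotient_map_tensor (F' := F') P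
  haveI : IsDomain (MvPolynomial ι L ⧸ P) := (Ideal.Quotient.isDomain_iff_prime P).2 (RingHom.ker_isPrime _)
  haveI : Algebra.FiniteType L (MvPolynomial ι L ⧸ P) :=
    Algebra.FiniteType.of_surjective (Ideal.Quotient.mkₐ L P) Ideal.Quotient.mk_surjective
  haveI : IsDomain (MvPolynomial ι F' ⧸ P.map (MvPolynomial.map (algebraMap L F'))) :=
    (Ideal.Quotient.isDomain_iff_prime _).2 hP'
  haveI : IsDomain (F' ⊗[L] (MvPolynomial ι L ⧸ P)) :=
    MulEquiv.isDomain (MvPolynomial ι F' ⧸ P.map (MvPolynomial.map (algebraMap L F'))) e.symm.toMulEquiv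
  haveI : IsDomain ((MvPolynomial ι L ⧸ P) ⊗[L] F') :=
    MulEquiv.isDomain (F' ⊗[L] (MvPolynomial ι L ⧸ P)) (Algebra.TensorProduct.comm L _ F').toMulEquiv
  have h2 : ringKrullDim (MvPolynomial ι F' ⧸ P.map (MvPolynomial.map (algebraMap L F'))) =
      ringKrullDim (F' ⊗[L] (MvPolynomial ι L ⧸ P)) :=
    ringKrullDim_eq_of_ringEquiv e.toRingEquiv
  have h3 : ringKrullDim (F' ⊗[L] (MvPolynomial ι L ⧸ P)) = ringKrullDim ((MvPolynomial ι L ⧸ P) ⊗[L] F') :=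
    ringKrullDim_eq_of_ringEquiv (Algebra.TensorProduct.comm L F' (MvPolynomial ι L ⧸ P)).toRingEquiv
  rw [h2, h3]
  exact ringKrullDim_tensorProduct_eq_of_isDomain (L := L) (F' := F') (MvPolynomial ι L ⧸ P)

end Literature.FieldTheory.Regular
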